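import Summits.MatrixMultiplication.OmegaCensus.STPPNearPeriod

/-!
# ω-census (abelian STPP census): filter N11 — the near-period / Kneser ENERGY filter (kernel)

HONEST FRAMING (pub-omega census; verbatim): lottery ticket; floor = certified bounds/negative ranges.
Census BOOKKEEPING (seat pub-omega-stpp-1 gen 25, 2026-08-27), family (b2).  A necessary condition on STPP families in finite
abelian groups — a tool for EXCLUDING candidate patterns of the finite census by theorem; nothing here is progress on `ω`.

## Statement

Let `(Aᵢ, Bᵢ, Cᵢ)_{i<N}` be an STPP family (CKSU 2005 Def. 5.1, the tree's `IsSTPP`) with non-empty sets in a finite abelian group `H`,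
`|H| = n`, and `X = ⋃ᵢ(Bᵢ − Aᵢ)`, `Y = ⋃ᵢ(Cᵢ − Bᵢ)`, `Z = ⋃ᵢ(Cᵢ − Aᵢ)` (`STPPKneserFilter.lean` §2: `|Xᵢ| = aᵢbᵢ`, `|Yᵢ| = bᵢcᵢ`,
`|Zᵢ| = aᵢcᵢ`, each family pairwise disjoint, `x + y = z` only inside one block).  Def. 5.1 gives SIX TRANSLATE COUNTS (§1; T1/T2 are
`card_filter_add_mem_le_card_A/_C` of `STPP222DensityBound.lean`, T4 is `rep_eq_card_B`):
* T1 `y ∈ Y_l`: `#{x ∈ X : x + y ∈ Z} ≤ a_l`;  T2 `x ∈ X_l`: `#{y ∈ Y : y + x ∈ Z} ≤ c_l`;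
* T3 `z ∈ Z_l`: `#{y ∈ Y : z − y ∈ X} ≤ b_l`;  T4 `z ∈ Z_l`: `#{x ∈ X : z − x ∈ Y} = b_l`;
* T5 `x ∈ X_l`: `#{z ∈ Z : z − x ∈ Y} ≤ c_l`;  T6 `y ∈ Y_l`: `#{z ∈ Z : z − y ∈ X} ≤ a_l`.
Each has the shape "the translate of `±S` by `w ∈ S'_l` lies in `H ∖ S''` up to `t_l` points".  NEAR-PERIODS (`STPPNearPeriod.lean`): two such translates
(`w, w' ∈ S'_L := ⋃_{l ∈ L} S'_l`, `t_l ≤ t`) meet in `≥ 2|S| − 2t − (n − |S''|) =: σ` points and the intersection injects into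
`S ∩ (S + (w − w'))`, so every `δ ∈ S'_L − S'_L` has `dif S δ ≥ σ`.  ENERGY: `Σ_δ dif S δ = |S|²`, `dif S 0 = |S|`, hence
`(#(S'_L − S'_L) − 1)·σ + |S| ≤ |S|²`.  KNESER (tree `exists_dvd_kneserLB_le_card_add`): `#(S'_L − S'_L) ≥ kneserLB(|S'_L|, |S'_L|, d) =
(2⌈|S'_L|/d⌉ − 1)·d` for SOME divisor `d` of `n`.  **Filter N11**: a pattern is dead at order `n` if for some rotation, some statement
T1–T6 and some block set `L`, EVERY divisor `d` of `n` has `(kneserLB(|S'_L|,|S'_L|,d) − 1)·σ + |S| > |S|²` (`N11Dead`, a decidable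
card-vector predicate with the bounded divisor quantifier of `N8Dead`; `not_isSTPP_of_n11Dead`).  N10 (`STPPRepresentationCount.lean`) is
the first-order statement "one translate fits"; N11 is the second-order one "two translates overlap".

Measured bite (HOME `pub-omega-stpp-1-g25/n11/`, numbers only, paper-grade until re-derived by the census seat): ℤ₅₇ front of record
(820 leaves alive under N7+N8+N9): N10-dead 4, N11-dead 491, alive 325; 0 of 568 FEASIBLE (pattern, group) pairs of the abelian `≤ 16`
census and 0 of 1 981 SAT-witnessed patterns of orders 48–57 are N11-dead (soundness checks of the arithmetic, not of this file).

References: H. Cohn, R. Kleinberg, B. Szegedy, C. Umans, FOCS 2005 (arXiv:math/0511460), Def. 5.1; M. Kneser, Math. Z. 58 (1953);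
M. B. Nathanson, *Additive Number Theory: Inverse Problems*, GTM 165, §4.
-/

open Finset
open scoped Pointwise

namespace Summit.MatrixMultiplication.OmegaCensus.CubeNB

variable {H : Type*} [AddCommGroup H] [DecidableEq H]

/-! ## §1 The STPP interface: the translate counts T3, T5, T6 (T1, T2, T4 are in the tree) and the six statements -/

section STPP

open Literature.Computability.AlgebraicComplexity

variable {N : ℕ} {A B C : Fin N → Finset H}

/-- **T3.** For `z = c' − a' ∈ Z_l`: the `y ∈ Y` with `z − y ∈ X` are among `c' − b`, `b ∈ B_l`. [cite: CohnKleinbergSzegedyUmans2005, Def. 5.1] -/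
theorem filter_sub_mem_Y_subset_image_B (hS : IsSTPP A B C) {l : Fin N} {a' c' : H} (ha' : a' ∈ A l) (hc' : c' ∈ C l) :
    (STPPKneser.DU B C univ).filter (fun y => c' - a' - y ∈ STPPKneser.DU A B univ) ⊆ (B l).image (fun b => c' - b) := by
  intro y hy
  rw [mem_filter] at hy
  obtain ⟨hyY, hxX⟩ := hy
  simp only [STPPKneser.DU, mem_biUnion, mem_univ, true_and] at hyY hxX
  obtain ⟨i, hy⟩ := hyY
  obtain ⟨j, hx⟩ := hxX
  obtain ⟨b'', hb'', c, hc, rfl⟩ := STPPKneser.mem_D.1 hy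
  obtain ⟨a, ha, b, hb, hx'⟩ := STPPKneser.mem_D.1 hx
  have hrel : (a - a') + (b'' - b) + (c' - c) = 0 := by
    have e : a = b - (c' - a' - (c - b'')) := by rw [← hx']; abel
    rw [e]; abel
  obtain ⟨-, hil, -, -, hcc⟩ := hS j i l a' ha' a ha b hb b'' hb'' c hc c' hc' hrel
  subst hil
  exact mem_image.2 ⟨b'', hb'', by rw [hcc]⟩

/-- **T5.** For `x = b − a ∈ X_l`: the `z ∈ Z` with `z − x ∈ Y` are among `c − a`, `c ∈ C_l`. [cite: CohnKleinbergSzegedyUmans2005, Def. 5.1] -/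
theorem filter_sub_mem_Z_subset_image_C (hS : IsSTPP A B C) {l : Fin N} {a b : H} (ha : a ∈ A l) (hb : b ∈ B l) :
    (STPPKneser.DU A C univ).filter (fun z => z - (b - a) ∈ STPPKneser.DU B C univ) ⊆ (C l).image (fun c => c - a) := by
  intro z hz
  rw [mem_filter] at hz
  obtain ⟨hzZ, hyY⟩ := hz
  simp only [STPPKneser.DU, mem_biUnion, mem_univ, true_and] at hzZ hyY
  obtain ⟨j, hz⟩ := hzZ
  obtain ⟨i, hy⟩ := hyY
  obtain ⟨a', ha', c', hc', rfl⟩ := STPPKneser.mem_D.1 hz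
  obtain ⟨b'', hb'', c'', hc'', hy'⟩ := STPPKneser.mem_D.1 hy
  have hrel : (a - a') + (b'' - b) + (c' - c'') = 0 := by
    have e : c'' = c' - a' - (b - a) + b'' := by rw [← hy']; abel
    rw [e]; abel
  obtain ⟨hli, hij, haa, -, -⟩ := hS l i j a' ha' a ha b hb b'' hb'' c'' hc'' c' hc' hrel
  subst hli; subst hij
  exact mem_image.2 ⟨c', hc', by rw [haa]⟩

/-- **T6.** For `y = c − b ∈ Y_l`: the `z ∈ Z` with `z − y ∈ X` are among `c − a`, `a ∈ A_l`. [cite: CohnKleinbergSzegedyUmans2005, Def. 5.1] -/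
theorem filter_sub_mem_Z_subset_image_A (hS : IsSTPP A B C) {l : Fin N} {b c : H} (hb : b ∈ B l) (hc : c ∈ C l) :
    (STPPKneser.DU A C univ).filter (fun z => z - (c - b) ∈ STPPKneser.DU A B univ) ⊆ (A l).image (fun a => c - a) := by
  intro z hz
  rw [mem_filter] at hz
  obtain ⟨hzZ, hxX⟩ := hz
  simp only [STPPKneser.DU, mem_biUnion, mem_univ, true_and] at hzZ hxX
  obtain ⟨j, hz⟩ := hzZ
  obtain ⟨i, hx⟩ := hxX
  obtain ⟨a', ha', c', hc', rfl⟩ := STPPKneser.mem_D.1 hz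
  obtain ⟨a'', ha'', b'', hb'', hx'⟩ := STPPKneser.mem_D.1 hx
  have hrel : (a'' - a') + (b - b'') + (c' - c) = 0 := by
    have e : a'' = b'' - (c' - a' - (c - b)) := by rw [← hx']; abel
    rw [e]; abel
  obtain ⟨hil, hlj, -, -, hcc⟩ := hS i l j a' ha' a'' ha'' b'' hb'' b hb c hc c' hc' hrel
  subst hil; subst hlj
  exact mem_image.2 ⟨a', ha', by rw [hcc]⟩

variable [Fintype H]

/-- The six N11 statements on one rotation, abstractly: given the three families, non-empty `L`, and the translate bound `t`, the
Kneser–energy contradiction.  T1: `S = X`, `S' = Y`, `S'' = Z`, `t ≥ a_l` (`l ∈ L`). [cite: CohnKleinbergSzegedyUmans2005, Def. 5.1] [cite: Kneser1953] -/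
theorem n11_T1 (hS : IsSTPP A B C) (hB : ∀ i, (B i).Nonempty) (hC : ∀ i, (C i).Nonempty) {n : ℕ} (hn : Fintype.card H = n)
    {L : Finset (Fin N)} (hL : L.Nonempty) {t : ℕ} (ht : ∀ l ∈ L, #(A l) ≤ t)
    (h : ∀ d : ℕ, d < n + 1 → d ∣ n → 0 < d → #(STPPKneser.DU A B univ) * #(STPPKneser.DU A B univ) <
      (STPPKneser.kneserLB #(STPPKneser.DU B C L) #(STPPKneser.DU B C L) d - 1) *
        (2 * #(STPPKneser.DU A B univ) + #(STPPKneser.DU A C univ) - (2 * t + n)) + #(STPPKneser.DU A B univ)) : False := by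
  refine false_of_forall_dvd_energy_lt (S := STPPKneser.DU A B univ) (W := STPPKneser.DU B C L) (R := STPPKneser.DU A C univ)
    (STPPKneser.DU_nonempty hL hB hC) hn (fun w hw w' hw' => ?_) h
  have hcol : ∀ y ∈ STPPKneser.DU B C L, #((STPPKneser.DU A B univ).filter fun x => x + y ∈ STPPKneser.DU A C univ) ≤ t := by
    intro y hy
    obtain ⟨l, hl, hy⟩ := mem_biUnion.1 hy
    exact (card_filter_add_mem_le_card_A hS hy).trans (ht l hl)
  exact le_dif_of_translate_add_le hcol hw hw'

/-- T2: `S = Y`, `S' = X`, `S'' = Z`, `t ≥ c_l`. [cite: CohnKleinbergSzegedyUmans2005, Def. 5.1] [cite: Kneser1953] -/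
theorem n11_T2 (hS : IsSTPP A B C) (hA : ∀ i, (A i).Nonempty) (hB : ∀ i, (B i).Nonempty) {n : ℕ} (hn : Fintype.card H = n)
    {L : Finset (Fin N)} (hL : L.Nonempty) {t : ℕ} (ht : ∀ l ∈ L, #(C l) ≤ t)
    (h : ∀ d : ℕ, d < n + 1 → d ∣ n → 0 < d → #(STPPKneser.DU B C univ) * #(STPPKneser.DU B C univ) <
      (STPPKneser.kneserLB #(STPPKneser.DU A B L) #(STPPKneser.DU A B L) d - 1) *
        (2 * #(STPPKneser.DU B C univ) + #(STPPKneser.DU A C univ) - (2 * t + n)) + #(STPPKneser.DU B C univ)) : False := by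
  refine false_of_forall_dvd_energy_lt (S := STPPKneser.DU B C univ) (W := STPPKneser.DU A B L) (R := STPPKneser.DU A C univ)
    (STPPKneser.DU_nonempty hL hA hB) hn (fun w hw w' hw' => ?_) h
  have hrow : ∀ x ∈ STPPKneser.DU A B L, #((STPPKneser.DU B C univ).filter fun y => y + x ∈ STPPKneser.DU A C univ) ≤ t := by
    intro x hx
    obtain ⟨l, hl, hx⟩ := mem_biUnion.1 hx
    exact (card_filter_add_mem_le_card_C hS hx).trans (ht l hl)
  exact le_dif_of_translate_add_le hrow hw hw'

/-- T3: `S = Y`, `S' = Z`, `S'' = X`, `t ≥ b_l`. [cite: CohnKleinbergSzegedyUmans2005, Def. 5.1] [cite: Kneser1953] -/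
theorem n11_T3 (hS : IsSTPP A B C) (hA : ∀ i, (A i).Nonempty) (hC : ∀ i, (C i).Nonempty) {n : ℕ} (hn : Fintype.card H = n)
    {L : Finset (Fin N)} (hL : L.Nonempty) {t : ℕ} (ht : ∀ l ∈ L, #(B l) ≤ t)
    (h : ∀ d : ℕ, d < n + 1 → d ∣ n → 0 < d → #(STPPKneser.DU B C univ) * #(STPPKneser.DU B C univ) <
      (STPPKneser.kneserLB #(STPPKneser.DU A C L) #(STPPKneser.DU A C L) d - 1) *
        (2 * #(STPPKneser.DU B C univ) + #(STPPKneser.DU A B univ) - (2 * t + n)) + #(STPPKneser.DU B C univ)) : False := by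
  refine false_of_forall_dvd_energy_lt (S := STPPKneser.DU B C univ) (W := STPPKneser.DU A C L) (R := STPPKneser.DU A B univ)
    (STPPKneser.DU_nonempty hL hA hC) hn (fun w hw w' hw' => ?_) h
  have hcnt : ∀ z ∈ STPPKneser.DU A C L, #((STPPKneser.DU B C univ).filter fun y => z - y ∈ STPPKneser.DU A B univ) ≤ t := by
    intro z hz
    obtain ⟨l, hl, hz⟩ := mem_biUnion.1 hz
    obtain ⟨a', ha', c', hc', rfl⟩ := STPPKneser.mem_D.1 hz
    exact ((card_le_card (filter_sub_mem_Y_subset_image_B hS ha' hc')).trans card_image_le).trans (ht l hl)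
  exact le_dif_of_translate_sub_le hcnt hw' hw

/-- T4: `S = X`, `S' = Z`, `S'' = Y`, `t ≥ b_l` (the representation count). [cite: CohnKleinbergSzegedyUmans2005, Def. 5.1] [cite: Kneser1953] -/
theorem n11_T4 (hS : IsSTPP A B C) (hA : ∀ i, (A i).Nonempty) (hC : ∀ i, (C i).Nonempty) {n : ℕ} (hn : Fintype.card H = n)
    {L : Finset (Fin N)} (hL : L.Nonempty) {t : ℕ} (ht : ∀ l ∈ L, #(B l) ≤ t)
    (h : ∀ d : ℕ, d < n + 1 → d ∣ n → 0 < d → #(STPPKneser.DU A B univ) * #(STPPKneser.DU A B univ) <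
      (STPPKneser.kneserLB #(STPPKneser.DU A C L) #(STPPKneser.DU A C L) d - 1) *
        (2 * #(STPPKneser.DU A B univ) + #(STPPKneser.DU B C univ) - (2 * t + n)) + #(STPPKneser.DU A B univ)) : False := by
  refine false_of_forall_dvd_energy_lt (S := STPPKneser.DU A B univ) (W := STPPKneser.DU A C L) (R := STPPKneser.DU B C univ)
    (STPPKneser.DU_nonempty hL hA hC) hn (fun w hw w' hw' => ?_) h
  have hcnt : ∀ z ∈ STPPKneser.DU A C L, #((STPPKneser.DU A B univ).filter fun x => z - x ∈ STPPKneser.DU B C univ) ≤ t := by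
    intro z hz
    obtain ⟨l, hl, hz⟩ := mem_biUnion.1 hz
    have := rep_eq_card_B hS hz
    rw [rep] at this
    rw [this]
    exact ht l hl
  exact le_dif_of_translate_sub_le hcnt hw' hw

/-- T5: `S = Z`, `S' = X`, `S'' = Y`, `t ≥ c_l`. [cite: CohnKleinbergSzegedyUmans2005, Def. 5.1] [cite: Kneser1953] -/
theorem n11_T5 (hS : IsSTPP A B C) (hA : ∀ i, (A i).Nonempty) (hB : ∀ i, (B i).Nonempty) {n : ℕ} (hn : Fintype.card H = n)
    {L : Finset (Fin N)} (hL : L.Nonempty) {t : ℕ} (ht : ∀ l ∈ L, #(C l) ≤ t)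
    (h : ∀ d : ℕ, d < n + 1 → d ∣ n → 0 < d → #(STPPKneser.DU A C univ) * #(STPPKneser.DU A C univ) <
      (STPPKneser.kneserLB #(STPPKneser.DU A B L) #(STPPKneser.DU A B L) d - 1) *
        (2 * #(STPPKneser.DU A C univ) + #(STPPKneser.DU B C univ) - (2 * t + n)) + #(STPPKneser.DU A C univ)) : False := by
  refine false_of_forall_dvd_energy_lt (S := STPPKneser.DU A C univ) (W := STPPKneser.DU A B L) (R := STPPKneser.DU B C univ)
    (STPPKneser.DU_nonempty hL hA hB) hn (fun w hw w' hw' => ?_) h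
  have hcnt : ∀ x ∈ STPPKneser.DU A B L, #((STPPKneser.DU A C univ).filter fun z => z - x ∈ STPPKneser.DU B C univ) ≤ t := by
    intro x hx
    obtain ⟨l, hl, hx⟩ := mem_biUnion.1 hx
    obtain ⟨a, ha, b, hb, rfl⟩ := STPPKneser.mem_D.1 hx
    exact ((card_le_card (filter_sub_mem_Z_subset_image_C hS ha hb)).trans card_image_le).trans (ht l hl)
  exact le_dif_of_translate_sub_right_le hcnt hw' hw

/-- T6: `S = Z`, `S' = Y`, `S'' = X`, `t ≥ a_l`. [cite: CohnKleinbergSzegedyUmans2005, Def. 5.1] [cite: Kneser1953] -/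
theorem n11_T6 (hS : IsSTPP A B C) (hB : ∀ i, (B i).Nonempty) (hC : ∀ i, (C i).Nonempty) {n : ℕ} (hn : Fintype.card H = n)
    {L : Finset (Fin N)} (hL : L.Nonempty) {t : ℕ} (ht : ∀ l ∈ L, #(A l) ≤ t)
    (h : ∀ d : ℕ, d < n + 1 → d ∣ n → 0 < d → #(STPPKneser.DU A C univ) * #(STPPKneser.DU A C univ) <
      (STPPKneser.kneserLB #(STPPKneser.DU B C L) #(STPPKneser.DU B C L) d - 1) *
        (2 * #(STPPKneser.DU A C univ) + #(STPPKneser.DU A B univ) - (2 * t + n)) + #(STPPKneser.DU A C univ)) : False := by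
  refine false_of_forall_dvd_energy_lt (S := STPPKneser.DU A C univ) (W := STPPKneser.DU B C L) (R := STPPKneser.DU A B univ)
    (STPPKneser.DU_nonempty hL hB hC) hn (fun w hw w' hw' => ?_) h
  have hcnt : ∀ y ∈ STPPKneser.DU B C L, #((STPPKneser.DU A C univ).filter fun z => z - y ∈ STPPKneser.DU A B univ) ≤ t := by
    intro y hy
    obtain ⟨l, hl, hy⟩ := mem_biUnion.1 hy
    obtain ⟨b, hb, c, hc, rfl⟩ := STPPKneser.mem_D.1 hy
    exact ((card_le_card (filter_sub_mem_Z_subset_image_A hS hb hc)).trans card_image_le).trans (ht l hl)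
  exact le_dif_of_translate_sub_right_le hcnt hw' hw

end STPP

/-! ## §2 The decidable card-vector predicate and the filter theorem -/

section Filter

/-- One N11 statement on numbers: `|S| = sS`, `|S''| = sR`, `|S'_L| = sW`, translate bound `t`, group order `n`: EVERY divisor `d` of
`n` violates the Kneser–energy inequality.  Bounded divisor quantifier as in `N8Dead1` (decidable). [folklore] -/
def n11Stmt (n sS sR sW t : ℕ) : Bool :=
  decide (∀ d : ℕ, d < n + 1 → d ∣ n → 0 < d → sS * sS < (STPPKneser.kneserLB sW sW d - 1) * (2 * sS + sR - (2 * t + n)) + sS)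

/-- **Filter N11, one rotation**, on the card vectors `(a, b, c)` of a pattern in a group of order `n`: for some threshold block `l₀` and one
of the six statements T1–T6 (with `S, S'', t = t_{l₀}` as in the file header and `S'_L` over `L = {l : t_l ≤ t_{l₀}}` — by monotonicity of
`kneserLB` in `|S'_L|` this is as strong as quantifying over all block sets `L`) the Kneser–energy inequality is violated for every
divisor of `n`.  Same verdicts as HOME `pub-omega-stpp-1-g25/n11/n11_filter.py` (identity rotation; `n11_threshold_check.py`). [folklore] -/
def N11Dead1 (n N : ℕ) (a b c : Fin N → ℕ) : Bool :=
  decide (∃ l₀ : Fin N,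
    n11Stmt n (∑ i, a i * b i) (∑ i, a i * c i) (∑ i ∈ univ.filter (fun i => a i ≤ a l₀), b i * c i) (a l₀) = true ∨
    n11Stmt n (∑ i, b i * c i) (∑ i, a i * c i) (∑ i ∈ univ.filter (fun i => c i ≤ c l₀), a i * b i) (c l₀) = true ∨
    n11Stmt n (∑ i, b i * c i) (∑ i, a i * b i) (∑ i ∈ univ.filter (fun i => b i ≤ b l₀), a i * c i) (b l₀) = true ∨
    n11Stmt n (∑ i, a i * b i) (∑ i, b i * c i) (∑ i ∈ univ.filter (fun i => b i ≤ b l₀), a i * c i) (b l₀) = true ∨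
    n11Stmt n (∑ i, a i * c i) (∑ i, b i * c i) (∑ i ∈ univ.filter (fun i => c i ≤ c l₀), a i * b i) (c l₀) = true ∨
    n11Stmt n (∑ i, a i * c i) (∑ i, a i * b i) (∑ i ∈ univ.filter (fun i => a i ≤ a l₀), b i * c i) (a l₀) = true)

/-- **Filter N11** on the card vectors: `N11Dead1` for one of the three rotations `(a,b,c)`, `(b,c,a)`, `(c,a,b)`. [folklore] -/
def N11Dead (n N : ℕ) (a b c : Fin N → ℕ) : Bool := N11Dead1 n N a b c || N11Dead1 n N b c a || N11Dead1 n N c a b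

variable [Fintype H] {N : ℕ} {A B C : Fin N → Finset H}

open Literature.Computability.AlgebraicComplexity

/-- **Filter N11, one rotation (kernel).**  An STPP family with non-empty sets whose card vectors satisfy `N11Dead1 |H|` does not exist.
[cite: Kneser1953] [cite: CohnKleinbergSzegedyUmans2005, Def. 5.1] -/
theorem not_isSTPP_of_n11Dead1 (hS : IsSTPP A B C) (hA : ∀ i, (A i).Nonempty) (hB : ∀ i, (B i).Nonempty)
    (hC : ∀ i, (C i).Nonempty) {n : ℕ} (hn : Fintype.card H = n) {a b c : Fin N → ℕ} (ha : ∀ i, #(A i) = a i)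
    (hb : ∀ i, #(B i) = b i) (hc : ∀ i, #(C i) = c i) (hdead : N11Dead1 n N a b c = true) : False := by
  obtain ⟨l₀, h⟩ := of_decide_eq_true hdead
  have hX : #(STPPKneser.DU A B univ) = ∑ i, a i * b i := by rw [STPPKneser.card_DU_AB hS hC]; simp_rw [ha, hb]
  have hY : #(STPPKneser.DU B C univ) = ∑ i, b i * c i := by rw [STPPKneser.card_DU_BC hS hA]; simp_rw [hb, hc]
  have hZ : #(STPPKneser.DU A C univ) = ∑ i, a i * c i := by rw [STPPKneser.card_DU_AC hS hB]; simp_rw [ha, hc]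
  have hXL : ∀ L : Finset (Fin N), #(STPPKneser.DU A B L) = ∑ i ∈ L, a i * b i := fun L => by
    rw [STPPKneser.card_DU_AB hS hC]; simp_rw [ha, hb]
  have hYL : ∀ L : Finset (Fin N), #(STPPKneser.DU B C L) = ∑ i ∈ L, b i * c i := fun L => by
    rw [STPPKneser.card_DU_BC hS hA]; simp_rw [hb, hc]
  have hZL : ∀ L : Finset (Fin N), #(STPPKneser.DU A C L) = ∑ i ∈ L, a i * c i := fun L => by
    rw [STPPKneser.card_DU_AC hS hB]; simp_rw [ha, hc]
  -- the threshold block sets and their bounds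
  set La := univ.filter (fun i => a i ≤ a l₀) with hLa
  set Lb := univ.filter (fun i => b i ≤ b l₀) with hLb
  set Lc := univ.filter (fun i => c i ≤ c l₀) with hLc
  have hLa0 : La.Nonempty := ⟨l₀, by simp [hLa]⟩
  have hLb0 : Lb.Nonempty := ⟨l₀, by simp [hLb]⟩
  have hLc0 : Lc.Nonempty := ⟨l₀, by simp [hLc]⟩
  have hta : ∀ l ∈ La, #(A l) ≤ a l₀ := fun l hl => by rw [ha]; exact (mem_filter.1 hl).2
  have htb : ∀ l ∈ Lb, #(B l) ≤ b l₀ := fun l hl => by rw [hb]; exact (mem_filter.1 hl).2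
  have htc : ∀ l ∈ Lc, #(C l) ≤ c l₀ := fun l hl => by rw [hc]; exact (mem_filter.1 hl).2
  rcases h with h | h | h | h | h | h
  · refine n11_T1 hS hB hC hn hLa0 hta ?_
    rw [hX, hZ, hYL]; exact of_decide_eq_true h
  · refine n11_T2 hS hA hB hn hLc0 htc ?_
    rw [hY, hZ, hXL]; exact of_decide_eq_true h
  · refine n11_T3 hS hA hC hn hLb0 htb ?_
    rw [hY, hX, hZL]; exact of_decide_eq_true h
  · refine n11_T4 hS hA hC hn hLb0 htb ?_
    rw [hX, hY, hZL]; exact of_decide_eq_true h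
  · refine n11_T5 hS hA hB hn hLc0 htc ?_
    rw [hZ, hY, hXL]; exact of_decide_eq_true h
  · refine n11_T6 hS hB hC hn hLa0 hta ?_
    rw [hZ, hX, hYL]; exact of_decide_eq_true h

/-- **Filter N11 (kernel): an STPP family with non-empty sets in a finite abelian group `H` whose pattern `(|Aᵢ|,|Bᵢ|,|Cᵢ|)ᵢ` is
`N11Dead |H|` does not exist** — the three rotations via `stpp_rotate`. [cite: Kneser1953] [cite: CohnKleinbergSzegedyUmans2005, Def. 5.1] -/
theorem not_isSTPP_of_n11Dead (hS : IsSTPP A B C) (hA : ∀ i, (A i).Nonempty) (hB : ∀ i, (B i).Nonempty)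
    (hC : ∀ i, (C i).Nonempty) {n : ℕ} (hn : Fintype.card H = n) {a b c : Fin N → ℕ} (ha : ∀ i, #(A i) = a i)
    (hb : ∀ i, #(B i) = b i) (hc : ∀ i, #(C i) = c i) (hdead : N11Dead n N a b c = true) : False := by
  simp only [N11Dead, Bool.or_eq_true] at hdead
  rcases hdead with (h | h) | h
  · exact not_isSTPP_of_n11Dead1 hS hA hB hC hn ha hb hc h
  · exact not_isSTPP_of_n11Dead1 (stpp_rotate hS) hB hC hA hn hb hc ha h
  · exact not_isSTPP_of_n11Dead1 (stpp_rotate (stpp_rotate hS)) hC hA hB hn hc ha hb h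

/-- Card-vector form with literal vectors: non-emptiness from positivity of the entries. [cite: Kneser1953] -/
theorem not_isSTPP_of_n11Dead' (hS : IsSTPP A B C) {n : ℕ} (hn : Fintype.card H = n) (a b c : Fin N → ℕ)
    (ha : ∀ i, #(A i) = a i) (hb : ∀ i, #(B i) = b i) (hc : ∀ i, #(C i) = c i)
    (hpos : ∀ i, 0 < a i ∧ 0 < b i ∧ 0 < c i) (hdead : N11Dead n N a b c = true) : False :=
  not_isSTPP_of_n11Dead hS (fun i => card_pos.1 ((ha i).symm ▸ (hpos i).1))
    (fun i => card_pos.1 ((hb i).symm ▸ (hpos i).2.1)) (fun i => card_pos.1 ((hc i).symm ▸ (hpos i).2.2))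
    hn ha hb hc hdead

end Filter

/-! ## §3 Example: a ℤ₅₇ frontier leaf (alive under N7, N8, N9, N10) decided by N11 -/

section Examples

variable [Fintype H]

open Literature.Computability.AlgebraicComplexity

/-- The ℤ₅₇ frontier leaf `{(1,1,5), (1,3,3), (2,2,5), (2,6,2)}` (`∑ abc = 58 > 57`; alive under the census filters N7–N10) carries no
STPP family in ANY abelian group of order `57`: statement T5 with `L` = all blocks reads "`Z` (`|Z| = 22`) has all `≥ 39` differences
of `X_L` (`|X_L| = 20`) as near-periods of strength `σ = 2·22 − 2·5 − (57 − 36) = 13`", and `38·13 + 22 = 516 > 484 = 22²` for every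
divisor of `57`. [cite: Kneser1953] [cite: CohnKleinbergSzegedyUmans2005, Def. 5.1] -/
theorem no_isSTPP_Z57_115_133_225_262 (hH : Fintype.card H = 57) (A B C : Fin 4 → Finset H) (hS : IsSTPP A B C)
    (hA : ∀ i, #(A i) = ![1, 1, 2, 2] i) (hB : ∀ i, #(B i) = ![1, 3, 2, 6] i) (hC : ∀ i, #(C i) = ![5, 3, 5, 2] i) : False :=
  not_isSTPP_of_n11Dead' hS hH _ _ _ hA hB hC (by decide) (by decide +kernel)

end Examples

end Summit.MatrixMultiplication.OmegaCensus.CubeNB
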